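import Summits.BirchSwinnertonDyer.BirchSwinnertonDyer.Theorems.PrintX11aNonSurjMuAnHardDefs
import Summits.BirchSwinnertonDyer.BirchSwinnertonDyer.Theorems.PrintX11aLowerHalfNonSurjChain
import Summits.BirchSwinnertonDyer.BirchSwinnertonDyer.Theorems.PrintX11aMuCertGivesConjA
import Literature.NumberTheory.EllipticCurves.AnalyticRankModularityProofs
import HarnessLib

/-!
# Route `PrintX11a` ∕ `ErratumRoadFive`: the THREE non-surjective `μ^an`-objects of X11a at `p ≥ 5` are ONE —
# `Theorems.X11aNonSurjMuAnHardFive` (U5's registered stub) ⟺ `Theorems.NonSurjCornerTwinMuAn` (K2's item 19948),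
# and either gives the `¬Surj ∧ 5 ≤ p` side of crux L's `stub_muAnDeepFive` (item 19064)
# (cell `bsd-print-x11a`, LEAD seat `bsd-line-x11a-p1` gen 1, D-0154 row 11; `--supports stmt-BirchSwinnertonDyer-19064`)

HONEST FRAMING.  BSD is not proved by any of this; nothing is asserted about any curve; no definition, no named fact minted,
no `sorry`.  Every theorem is CONDITIONAL on an OPEN `@[conjecture]` constant of the tree (Greenberg's analytic `μ = 0` on a
non-surjective X11a locus — LNM 1716 Conj. 1.11 read through the main conjecture) and, where marked, on ONE named published
fact (Balakrishnan–Dogra–Müller–Tuitman–Vonk 2019 Thm. 1.2, `thm12_not_le_normalizer_splitCartan`).  Items 19064 ∕ 19948 ∕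
20614 do NOT close by this file.

WHY.  Three seats cut Greenberg's `μ^an = 0` on the non-surjective X11a pairs three ways:
* K2 (route `ErratumRoadFive`, item stmt-BirchSwinnertonDyer-19948): `Theorems.NonSurjCornerTwinMuAn` — ALL pairs with `ρ̄` not
  onto, `p ∈ {5,7}`, `p ∣ ord_p Δ_min`;
* U5 (crux stmt-BirchSwinnertonDyer-20614, line finemu5 r1–r5, registered stub `stub_muAnHardFive`, verdict «promote-stub» by
  five concurring leads): `Theorems.X11aNonSurjMuAnHardFive` — pairs with `ρ̄` not onto, `5 ≤ p`, on the HARD sub-locus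
  {split at `p`} ∪ {`ord_p(L(E,1)/Ω_E) ≠ 0`};
* L (crux stmt-BirchSwinnertonDyer-19064, line birth r3/r4, registered stub `stub_muAnDeepFive`): `X11a.MuAnZeroAt W p` at the
  DEEP pairs (`#Ш_an` not a `p`-adic unit), `5 ≤ p`, BOTH images.
This file proves, so that ONE item serves all three:
* §1 `ClassX11a.norm_coeff_zero_eq_one_of_nonsplit_of_unit_value` ∕ `ClassX11a.muAnZeroAt_of_nonsplit_of_unit_value` — OFF the
  hard sub-locus (non-split `p`, `L(E,1)/Ω_E = t` with `ord_p t = 0`) the certificate holds OUTRIGHT: the constant term of the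
  Néron-normalised non-split Mazur–Tate–Teitelbaum function is `2ϖ[0]⁺_f = 2t` (MTT §I.10 at `a_p = −1`, no exceptional zero),
  a `p`-adic unit for odd `p`.  FACT-FREE: `L(E,1) ≠ 0` is read off `r_an = 0` through the newform `f` in the certificate's own
  binder (Hecke's continuation for `L(f,s) = L(E,s)`, `WeierstrassCurve.hasEntireLFunction_of_cuspCoeff_eq`), not through the
  named modularity fact (cf. x11a-p3's `ClassX11a.conjAAt_of_muAnHard_of_not_surj`, which reads `hasEntireLFunction_rat`).
* §2 `nonSurjCornerTwinMuAn_of_x11aNonSurjMuAnHardFive : X11aNonSurjMuAnHardFive → NonSurjCornerTwinMuAn` — FACT-FREE (U5's stub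
  implies K2's item); `x11aNonSurjMuAnHardFive_of_nonSurjCornerTwinMuAn : thm12_… → NonSurjCornerTwinMuAn → X11aNonSurjMuAnHardFive`
  (K2's item implies U5's stub, modulo BDMTV: `¬Surj ∧ Irr ∧ Mult ∧ 5 ≤ p ⟹ p ∈ {5,7}` by
  `GaloisImage.eq_five_or_eq_seven_of_mult_of_irr_of_not_surj`, and `p ∣ ord_p Δ_min` by Tate's transvection
  `ClassX11a.surj_of_not_dvd`).  READING for the planners of 20614 ∕ 19065: the stub five leads asked to promote IS item 19948
  (modulo one print fact one way, nothing the other way) — no new item is needed for it.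
* §3 `muAnZeroAt_of_not_surj_of_five_le_of_x11aNonSurjMuAnHardFive` (fact-free) and `…_of_nonSurjCornerTwinMuAn` (mod BDMTV):
  either constant gives `∀ (W,p) ∈ X11a, ¬Surj → 5 ≤ p → X11a.MuAnZeroAt W p` — the non-surjective side of L's registered
  `stub_muAnDeepFive` with its `¬ShaAnUnit` binder unused; so after the lead's reshape r5 of line «birth» the `p ≥ 5` residual
  of crux L that is NOT already an item is the SURJECTIVE deep locus alone (barrier B3's object).

References: [GreenbergLNM1716] §1 Conj. 1.11 (p. 61), §4 (PDF p. 113: `l_v = 2` at non-split `v`); [MazurTateTeitelbaum1986]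
§I.10, §I.14; [BalakrishnanEtAl2019] Thm. 1.2; [SilvermanATAEC1994] V.6 Prop. 6.1; [Serre1972] Prop. 15; [DiamondShurman2005]
Thm. 5.10.2; tree `Theorems/PrintX11aNonSurjMuAnHardDefs.lean` (p553242), `Theorems/ErratumRoadFiveNonSurjCornerBranchesDefs.lean`,
`Theorems/PrintX11aLowerHalfNonSurjChain.lean` (p609418), `Theorems/PrintX11aMuCertGivesConjA.lean` (p609537).
-/

set_option linter.dupNamespace false
set_option autoImplicit false

noncomputable section

open scoped Classical MatrixGroups ModularForm

open CongruenceSubgroup WeierstrassCurve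
  Literature.NumberTheory.EllipticCurves
  Literature.NumberTheory.EllipticCurves.ModularForms
  Literature.NumberTheory.EllipticCurves.Rank1Residual
  Literature.NumberTheory.EllipticCurves.Rank1Residual.Typed
  Literature.NumberTheory.EllipticCurves.BalakrishnanEtAl2019
  Summit.BirchSwinnertonDyer.Rank1Residual

namespace Summit.BirchSwinnertonDyer.BirchSwinnertonDyer.Theorems

/-! ## §1 Off the hard sub-locus the certificate is free (fact-free) -/

section UnitValue

variable {W : WeierstrassCurve ℚ} [W.IsElliptic] [W.IsGloballyMinimal] {p : ℕ} [Fact p.Prime]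

/-- **Non-split `p`, unit special value ⟹ the constant term of the Néron-normalised non-split MTT function is a `p`-adic unit**
(fact-free).  At an X11a pair (`r_an = 0`, `p` odd) with `p` non-split and `L(E,1)/Ω_E = t`, `ord_p t = 0`: for every newform
`f` of `E`, every `ϖ` with `ϖΩ_E = Ω⁺_f` and every `L` with `IsMultPAdicLFunctionOf f p (−1) L`, `‖[T⁰](ϖ·L)‖_p = ‖2t‖_p = 1`.
`L(E,1) ≠ 0` comes from `r_an = 0` through `f` itself (Hecke), no named fact.
[cite: MazurTateTeitelbaum1986, §I.10 (ε(p) = 0, α = a_p = −1)] [cite: GreenbergLNM1716, §4 (PDF p. 113)] [cite: DiamondShurman2005, Thm. 5.10.2] -/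
theorem _root_.Summit.BirchSwinnertonDyer.Rank1Residual.ClassX11a.norm_coeff_zero_eq_one_of_nonsplit_of_unit_value
    (hX : ClassX11a W p) {t : ℚ} (ht : W.entireLFunction 1 / (W.realPeriodRat : ℂ) = (t : ℂ))
    (hunit : padicValRat p t = 0) {N : ℕ} [NeZero N] {f : CuspForm (Gamma0 N) 2} (hf : IsNewformOf W f)
    {ϖ : ℚ} (hϖ : (ϖ : ℝ) * W.realPeriodRat = plusPeriod f) {L : PowerSeries ℚ_[p]}
    (hL : IsMultPAdicLFunctionOf f p (-1) L) :
    ‖PowerSeries.coeff 0 (PowerSeries.C ((ϖ : ℚ) : ℚ_[p]) * L)‖ = 1 := by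
  have hp2 : p ≠ 2 := hX.2.1
  -- `L(E,1) ≠ 0` from `r_an = 0`, the continuation being Hecke's for `L(f,s) = L(E,s)`
  have hent : W.HasEntireLFunction :=
    W.hasEntireLFunction_of_cuspCoeff_eq (strictWidthInfty_Gamma0 _) f hf.2
  have hL1 : W.entireLFunction 1 ≠ 0 := (W.analyticRank_eq_zero_iff_holds hent).mp hX.1
  have hΩC : (W.realPeriodRat : ℂ) ≠ 0 := Complex.ofReal_ne_zero.mpr W.realPeriodRat_pos_holds.ne'
  have ht0 : t ≠ 0 := by
    rintro rfl
    apply hL1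
    rw [← div_mul_cancel₀ (W.entireLFunction 1) hΩC, ht]
    simp
  -- `ϖ · [0]⁺_f = L(E,1)/Ω_E = t`
  have hq : W.entireLFunction 1 / (W.realPeriodRat : ℂ) = (((ϖ * ratPlusSymbol f 0 : ℚ)) : ℂ) := by
    rw [hf.entireLFunction_one_eq, ← hϖ, div_eq_iff hΩC]
    push_cast
    ring
  have hteq : ϖ * ratPlusSymbol f 0 = t := by exact_mod_cast (ht.symm.trans hq).symm
  have hne : ϖ * ratPlusSymbol f 0 ≠ 0 := hteq ▸ ht0
  have hval : padicValRat p (ϖ * ratPlusSymbol f 0) = 0 := hteq ▸ hunit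
  have hnorm : ‖(((ϖ * ratPlusSymbol f 0 : ℚ)) : ℚ_[p])‖ = 1 := by
    rw [Padic.eq_padicNorm, padicNorm.eq_zpow_of_nonzero hne, hval, neg_zero, zpow_zero, Rat.cast_one]
  -- `‖2‖_p = 1` (`p` odd)
  have h2 : ‖(2 : ℚ_[p])‖ = 1 := by
    have hle : ‖((2 : ℤ) : ℚ_[p])‖ ≤ 1 := Padic.norm_int_le_one 2
    have hnlt : ¬ ‖((2 : ℤ) : ℚ_[p])‖ < 1 := by
      rw [Padic.norm_intCast_lt_one_iff]
      intro h
      have hp : p ∣ 2 := by exact_mod_cast h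
      exact hp2 ((Nat.prime_dvd_prime_iff_eq (Fact.out) Nat.prime_two).mp hp)
    have h2z : ((2 : ℤ) : ℚ_[p]) = (2 : ℚ_[p]) := by norm_num
    rw [h2z] at hle hnlt
    exact le_antisymm hle (not_lt.mp hnlt)
  rw [PowerSeries.coeff_C_mul, PowerSeries.coeff_zero_eq_constantCoeff_apply, hL.constantCoeff_of_neg_one,
    mul_left_comm, norm_mul, h2, one_mul, ← Rat.cast_mul, hnorm]

/-- **Off the hard sub-locus `μ^an(E,p) = 0` holds outright** (fact-free): at an X11a pair with `p` NON-split and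
`L(E,1)/Ω_E` a rational `p`-adic unit, `X11a.MuAnZeroAt W p` (witness: the constant term, §1).
[cite: MazurTateTeitelbaum1986, §I.10] [cite: GreenbergLNM1716, §4 (PDF p. 113) and Conj. 1.11] -/
theorem _root_.Summit.BirchSwinnertonDyer.Rank1Residual.ClassX11a.muAnZeroAt_of_nonsplit_of_unit_value
    (hX : ClassX11a W p) (hnsp : ¬ W.HasSplitMultiplicativeReductionAtPrime p) {t : ℚ}
    (ht : W.entireLFunction 1 / (W.realPeriodRat : ℂ) = (t : ℂ)) (hunit : padicValRat p t = 0) :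
    X11a.MuAnZeroAt W p := by
  intro N _ f hf ϖ hϖ
  exact ⟨fun _ L hL => ⟨0, hX.norm_coeff_zero_eq_one_of_nonsplit_of_unit_value ht hunit hf hϖ hL⟩,
    fun hs => absurd hs hnsp⟩

/-- **The hard-locus certificate in the «allowable root» currency extends to the whole pair set** (fact-free): if the
certificate holds whenever the pair is hard, it holds always — off the hard locus by §1.
[cite: MazurTateTeitelbaum1986, §I.10 and §I.14] [cite: GreenbergLNM1716, Conj. 1.11 (shape)] -/
theorem _root_.Summit.BirchSwinnertonDyer.Rank1Residual.ClassX11a.allowableRootShape_of_hard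
    (hX : ClassX11a W p)
    (hH : (W.HasSplitMultiplicativeReductionAtPrime p ∨
        ∀ t : ℚ, W.entireLFunction 1 / (W.realPeriodRat : ℂ) = (t : ℂ) → padicValRat p t ≠ 0) →
      ∀ {N : ℕ} [NeZero N] (f : CuspForm (Gamma0 N) 2), IsNewformOf W f →
        ∀ (ϖ : ℚ), (ϖ : ℝ) * W.realPeriodRat = plusPeriod f →
        ∀ (a : ℚ_[p]) (L : PowerSeries ℚ_[p]),
          (W.HasSplitMultiplicativeReductionAtPrime p → a = 1) →
          (¬ W.HasSplitMultiplicativeReductionAtPrime p → a = -1) →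
          IsMultPAdicLFunctionOf f p a L →
          ∃ n : ℕ, ‖PowerSeries.coeff n (PowerSeries.C ((ϖ : ℚ) : ℚ_[p]) * L)‖ = 1)
    {N : ℕ} [NeZero N] (f : CuspForm (Gamma0 N) 2) (hf : IsNewformOf W f)
    (ϖ : ℚ) (hϖ : (ϖ : ℝ) * W.realPeriodRat = plusPeriod f) (a : ℚ_[p]) (L : PowerSeries ℚ_[p])
    (hsa : W.HasSplitMultiplicativeReductionAtPrime p → a = 1)
    (hna : ¬ W.HasSplitMultiplicativeReductionAtPrime p → a = -1) (hL : IsMultPAdicLFunctionOf f p a L) :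
    ∃ n : ℕ, ‖PowerSeries.coeff n (PowerSeries.C ((ϖ : ℚ) : ℚ_[p]) * L)‖ = 1 := by
  by_cases hhard : W.HasSplitMultiplicativeReductionAtPrime p ∨
      ∀ t : ℚ, W.entireLFunction 1 / (W.realPeriodRat : ℂ) = (t : ℂ) → padicValRat p t ≠ 0
  · exact hH hhard f hf ϖ hϖ a L hsa hna hL
  · push Not at hhard
    obtain ⟨hnsp, t, ht, hunit⟩ := hhard
    have ha : a = -1 := hna hnsp
    subst ha
    exact ⟨0, hX.norm_coeff_zero_eq_one_of_nonsplit_of_unit_value ht hunit hf hϖ hL⟩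

end UnitValue

/-! ## §2 U5's registered stub ⟺ K2's item 19948 -/

/-- **U5's stub implies K2's item, FACT-FREE**: `X11aNonSurjMuAnHardFive → NonSurjCornerTwinMuAn`.  At a pair of 19948's locus
(`¬Surj`, `p ∈ {5,7}` so `5 ≤ p`; the hypothesis `p ∣ ord_p Δ_min` is not needed) the hard-locus certificate extends off the hard
locus by §1. [cite: GreenbergLNM1716, §1 Conj. 1.11 (p. 61)] [cite: MazurTateTeitelbaum1986, §I.10] -/
theorem nonSurjCornerTwinMuAn_of_x11aNonSurjMuAnHardFive (hH : X11aNonSurjMuAnHardFive) : NonSurjCornerTwinMuAn := by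
  intro W _ _ p _ hX hns h57 _hdvd N _ f hf ϖ hϖ a L hsa hna hL
  have hp5 : 5 ≤ p := by rcases h57 with rfl | rfl <;> omega
  exact hX.allowableRootShape_of_hard (fun hhard => hH W p hX hns hp5 hhard) f hf ϖ hϖ a L hsa hna hL

/-- **K2's item implies U5's stub, modulo BDMTV**: `thm12_not_le_normalizer_splitCartan → NonSurjCornerTwinMuAn → X11aNonSurjMuAnHardFive`.
At a pair of U5's locus (`¬Surj`, `5 ≤ p`, hard): `p ∈ {5,7}` by Balakrishnan–Dogra–Müller–Tuitman–Vonk Thm. 1.2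
(`GaloisImage.eq_five_or_eq_seven_of_mult_of_irr_of_not_surj`) and `p ∣ ord_p Δ_min` by Tate's transvection
(`ClassX11a.surj_of_not_dvd`); the hard-locus hypothesis is simply dropped.
[cite: BalakrishnanEtAl2019, §1 Thm. 1.2 (arXiv:1711.05846 p. 2)] [cite: SilvermanATAEC1994, V.6 Prop. 6.1 (p. 410)]
[cite: GreenbergLNM1716, §1 Conj. 1.11 (p. 61)] -/
theorem x11aNonSurjMuAnHardFive_of_nonSurjCornerTwinMuAn (hB : thm12_not_le_normalizer_splitCartan)
    (h57 : NonSurjCornerTwinMuAn) : X11aNonSurjMuAnHardFive := by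
  intro W _ _ p _ hX hns hp5 _hhard N _ f hf ϖ hϖ a L hsa hna hL
  have h57' : p = 5 ∨ p = 7 :=
    GaloisImage.eq_five_or_eq_seven_of_mult_of_irr_of_not_surj W p hB hp5 hX.mult hX.irr hns
  have hdvd : p ∣ padicValInt p W.minimalDiscriminantInt := by
    by_contra hΔ
    exact hns (hX.surj_of_not_dvd W p hΔ)
  exact h57 W p hX hns h57' hdvd f hf ϖ hϖ a L hsa hna hL

/-! ## §3 Either constant gives the non-surjective `p ≥ 5` side of L's `stub_muAnDeepFive` -/

/-- **From U5's stub, FACT-FREE**: `X11aNonSurjMuAnHardFive → ∀ (W,p) ∈ X11a, ¬Surj → 5 ≤ p → X11a.MuAnZeroAt W p`.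
[cite: GreenbergLNM1716, §1 Conj. 1.11 (p. 61)] [cite: MazurTateTeitelbaum1986, §I.10 and §I.14] -/
theorem muAnZeroAt_of_not_surj_of_five_le_of_x11aNonSurjMuAnHardFive (hH : X11aNonSurjMuAnHardFive) :
    ∀ (W : WeierstrassCurve ℚ) [W.IsElliptic] [W.IsGloballyMinimal] (p : ℕ) [Fact p.Prime],
      ClassX11a W p → ¬ Surj W p → 5 ≤ p → X11a.MuAnZeroAt W p := by
  intro W _ _ p _ hX hns hp5
  exact NonSurjChain.muAnZeroAt_of_allowableRootShape W p (fun f hf ϖ hϖ a L hsa hna hL =>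
    hX.allowableRootShape_of_hard (fun hhard => hH W p hX hns hp5 hhard) f hf ϖ hϖ a L hsa hna hL)

/-- **From K2's item 19948, modulo BDMTV**: `thm12_… → NonSurjCornerTwinMuAn → ∀ (W,p) ∈ X11a, ¬Surj → 5 ≤ p → X11a.MuAnZeroAt W p`
(cf. er5-p2's `NonSurjChain.lowerNonSurj_five_of_nonSurjCornerTwinMuAn_of_facts`, where this step is inlined).
[cite: BalakrishnanEtAl2019, §1 Thm. 1.2] [cite: GreenbergLNM1716, §1 Conj. 1.11 (p. 61)] -/
theorem muAnZeroAt_of_not_surj_of_five_le_of_nonSurjCornerTwinMuAn (hB : thm12_not_le_normalizer_splitCartan)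
    (h57 : NonSurjCornerTwinMuAn) :
    ∀ (W : WeierstrassCurve ℚ) [W.IsElliptic] [W.IsGloballyMinimal] (p : ℕ) [Fact p.Prime],
      ClassX11a W p → ¬ Surj W p → 5 ≤ p → X11a.MuAnZeroAt W p :=
  muAnZeroAt_of_not_surj_of_five_le_of_x11aNonSurjMuAnHardFive
    (x11aNonSurjMuAnHardFive_of_nonSurjCornerTwinMuAn hB h57)

/-- **L's registered stub `stub_muAnDeepFive` from K2's item 19948 (non-surjective side, mod BDMTV) and the SURJECTIVE deep residual**
(pure logic): the reshape r5 of line «birth» on crux 19064 in one implication.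
[cite: GreenbergLNM1716, §1 Conj. 1.11 (p. 61)] [cite: BalakrishnanEtAl2019, §1 Thm. 1.2] -/
theorem muAnDeepFive_of_nonSurjCornerTwinMuAn_of_surjDeep (hB : thm12_not_le_normalizer_splitCartan)
    (h57 : NonSurjCornerTwinMuAn)
    (hS : ∀ (W : WeierstrassCurve ℚ) [W.IsElliptic] [W.IsGloballyMinimal] (p : ℕ) [Fact p.Prime],
      ClassX11a W p → 5 ≤ p → Surj W p → ¬ X11a.ShaAnUnit W p → X11a.MuAnZeroAt W p) :
    ∀ (W : WeierstrassCurve ℚ) [W.IsElliptic] [W.IsGloballyMinimal] (p : ℕ) [Fact p.Prime],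
      ClassX11a W p → 5 ≤ p → ¬ X11a.ShaAnUnit W p → X11a.MuAnZeroAt W p := by
  intro W _ _ p _ hX hp5 hu
  by_cases hs : Surj W p
  · exact hS W p hX hp5 hs hu
  · exact muAnZeroAt_of_not_surj_of_five_le_of_nonSurjCornerTwinMuAn hB h57 W p hX hs hp5

end Summit.BirchSwinnertonDyer.BirchSwinnertonDyer.Theorems

end
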